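import Literature.MathematicalPhysics.QuantumFieldTheory.Balaban1983to89.B6RandomWalkBlocks
import Literature.MathematicalPhysics.QuantumFieldTheory.Balaban1983to89.B9Eq376POneLetters
import Literature.MathematicalPhysics.QuantumFieldTheory.Balaban1983to89.B9Ineq377POne
import Literature.MathematicalPhysics.QuantumFieldTheory.Balaban1983to89.B9Ineq386V3Concrete

/-!
# `Balaban1983to89.B9Ineq377POneConcrete` — [Balaban1985BackgroundPropagators] (3.77) p. 406 «the operator P₁(A) is a non-local operator
# whose kernel satisfies the bound |P_{1,μν}(A; x, x′)| ≦ O(1)α₁(Lʲη)⁻²(L^{j′}η)^{−d}e^{−(1/2)δ₀d(y,y′)}» FOR THE CONCRETE `P₁(A)` OF (3.76) —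
# the letters `D_U`, `D*_U`, `D_{U′U} − D_U`, `D*_{U′U} − D*_U` concrete (FILE 10 `B9Eq376POneLetters`), typed between the site and the bond
# carrier and embedded into ONE carrier by FILE 9 `B6RandomWalkBlocks.emb₄`, so that the device `B9Ineq377POne.ineq377_op` applies; and
# Theorem 3.4's `G`-clause (entries (3.42)₁, (3.42)₃) with `V₃(A)` AND `P₁(A)` concrete (file 8 `B9Ineq386V3Concrete` + `eq376_concrete`)

statement-level skeleton of published theorems with citation tags; proofs where landed; nothing here is a claim about the Yang–Mills mass gap

CITATION HEADER (lean-in-tree rule).  B9 = T. Bałaban, *Propagators for lattice gauge theories in a background field*, Commun. Math. Phys.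
**99** (1985) 389–434 [Balaban1985BackgroundPropagators] (held `paper:balaban1985-cmp99-background-propagators`; journal page = PDF page + 388):
(3.76)–(3.77) pp. 405–406, (3.49) p. 399 (entries of `P(U)`), (3.68) p. 403 (`P(U′U) = P(U) + P′(A)` and the entries of `P′`), (3.70)/(3.74)
pp. 404–405, (3.37) p. 396, Thm 3.4 p. 400 with (3.82)–(3.86) p. 407.  [4] = [Balaban1984PropagatorsII] Lemma 2.1 p. 234, (2.51)–(2.55) p. 232,
(2.61).  Cell `lit-balaban`, seat r06 (B9 fold owner) gen 11, FILE 11 of the G-side programme; rows B9.Eq3.76, B9.Ineq3.77, B9.Thm3.4, B9.Eq3.85.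

THE PRINT (p. 406, OCR of the held scan checked against the page image): «The operator P₁(A) was defined in (3.76). It is a non-local bounded
operator … |P_{1,μν}(A; x, x′)| ≦ O(1)α₁(Lʲη)⁻²(L^{j′}η)^{−d} exp(−½δ₀d(y,y′))  (3.77)».  The cell's operator form of (3.77) is
`B9Ineq377POne.ineq377_op` (pv-seat; seven words, [4] (2.52)–(2.55) + Lemma 2.1); its letters `D`, `D*`, `E = D_{U′U} − D_U`, `E*`, `P`, `P′` are
endomorphisms of ONE carrier.  Here the differential letters are the CONCRETE two-space letters of FILE 10 and the one-carrier device is reached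
through the 2×2 block embedding of FILE 9 (`emb₄`; products of embedded letters = embedded composites, `emb₄_mul`).

WHAT THIS FILE PROVES (0 sorry; theorems only).
* §1 `emb₄_C_mul_A`, `emb₄_A_mul_B`, `emb₄_C_mul_B`, `emb₄_C_mul_A_mul_B`, `pOne_emb₄` — the block bookkeeping: the (3.76) words of letters
  typed sites→bonds (`C`-block), bonds→sites (`B`-block), sites→sites (`A`-block) multiply inside `emb₄` to the bond block (`D`-block), and
  `B9Eq386Neumann.pOne` of the embedded letters is the embedded two-space `P₁`.
* §1 `ineq377_hom` — **(3.77) FOR LETTERS TYPED BETWEEN TWO CARRIERS**: `ineq377_op` with `D, D′, E : X → Y`, `D*, D*′, E* : Y → X`, `P, P′ : X → X`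
  and the hypotheses as `HasMajorantHom`/`HasMajorant` of the typed composites; conclusion `P₁ ≺ κ₃₇₇α₁(Lʲη)⁻²e^{−ρd}` on the `Y` (bond) carrier.
* §2 `ineq377_concreteE` — **(3.77) WITH THE DIFFERENTIAL LETTERS CONCRETE**: `X` = site coordinates `S × ι`, `Y` = bond coordinates `(κ × S) × ι`,
  `D := conjHom b (η⁻¹D¹_U)`, `D′ := conjHom b (η⁻¹D¹_{U′U})`, `D*`, `D*′` likewise (FILE 10), `E`, `E*` their differences with FILE 10's sizes
  (`c_E = 4(1 + card κ)·M₂Σ_i‖b_i‖·e^{δd₀}`) under (3.37) blockwise (`‖A‖, ‖τ*A‖ ≦ α₁(Lʲη)⁻¹`), `ηα₁(Lʲη)⁻¹ ≦ 1/4`, a group-valued background;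
  the projection letters `P = P(U)`, `P′ = P′(A)` of the site carrier and their (3.49)/(3.68) entries stay hypotheses (typed composites).
* §3 `thm34_G_entries13_concreteV₃P₁` — file 8's `B9Ineq386V3Concrete.thm34_G_entries13_concreteV₃` with its hypotheses `h376` (:= FILE 10
  `eq376_concrete`) and `hP₁` (:= §2) DISCHARGED: `DRD*` and `D′R′D′*` concrete (`R = 1 − P`, `R′ = 1 − (P + P′)`), `κ₁ = κ₃₇₇(c_E, κ_P, κ_{P′}, Λ,
  c₁(β), α₁)` explicit; the P-entries enter at a rate `δ_P ≧ δ + 2(α+β)δ₀` (two composition levels of (3.77)).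

HONEST SCOPE / NOT CLAIMED.  The entries (3.49) of `P(U)` and (3.68) of `P′(A)` are INPUTS (the cell has (3.49) in operator form,
`B9Ineq368PPrime.ineq349_op`, on one carrier; wiring it to the typed composites here is bookkeeping left open); `P₂(A)`, (3.80), `Δ_aG = GΔ_a = 1`
and Theorem 3.3's entries for `G(U)` stay abstract as in file 8; no kernel↔block identification; NOT summit progress.

RELATED IN THE TREE, NOT DUPLICATED (searched 2026-08-21: `lean search 'ineq377_hom|ineq377_concrete|pOne_emb₄|concreteV₃P₁'` = ∅; `ineq377_op`,
`eq376_concrete`, `hasMajorantHom_gradLin_sub`/`_divLin_sub`, `emb₄`/`hasMajorant_emb₄_*`/`hasMajorant_of_emb₄_inr_inr`, `thm34_G_entries13_concreteV₃`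
are used BY NAME).
-/

noncomputable section

namespace Literature.MathematicalPhysics.QuantumFieldTheory.Balaban1983to89.B9Ineq377POneConcrete

open NormedSpace Complex
open Literature.MathematicalPhysics.QuantumFieldTheory.Balaban1983to89
open Literature.MathematicalPhysics.QuantumFieldTheory.Balaban1983to89.B6RandomWalk (HasMajorant hasMajorant_mono hasMajorant_add
  Triangle254 Ineq261)
open Literature.MathematicalPhysics.QuantumFieldTheory.Balaban1983to89.B6RandomWalkHom (HasMajorantHom hasMajorantHom_mono)
open Literature.MathematicalPhysics.QuantumFieldTheory.Balaban1983to89.B6RandomWalkBlocks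
open Literature.MathematicalPhysics.QuantumFieldTheory.Balaban1983to89.B9Thm34Ext (toB6)
open Literature.MathematicalPhysics.QuantumFieldTheory.Balaban1983to89.B9Ineq347 (ScaleTransfer)
open Literature.MathematicalPhysics.QuantumFieldTheory.Balaban1983to89.B9Eq386Neumann (pOne vTotal vThree pTwo deltaA)
open Literature.MathematicalPhysics.QuantumFieldTheory.Balaban1983to89.B9Ineq377POne (kappa377 kappa377_nonneg ineq377_op)
open Literature.MathematicalPhysics.QuantumFieldTheory.Balaban1983to89.B9Ineq385VG (kappa385 kappa385_nonneg)
open Literature.MathematicalPhysics.QuantumFieldTheory.Balaban1983to89.B9Eq39Adjoint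
open Literature.MathematicalPhysics.QuantumFieldTheory.Balaban1983to89.B9Eq369Small (Through)
open Literature.MathematicalPhysics.QuantumFieldTheory.Balaban1983to89.B9Eq372Locality (stBonds)
open Literature.MathematicalPhysics.QuantumFieldTheory.Balaban1983to89.B9Eq352DivForm (tauF tauB)
open Literature.MathematicalPhysics.QuantumFieldTheory.Balaban1983to89.B9Eq352DivFormLetters
open Literature.MathematicalPhysics.QuantumFieldTheory.Balaban1983to89.B9Eq352GradLetters (diffLetter)
open Literature.MathematicalPhysics.QuantumFieldTheory.Balaban1983to89.B9Eq371GradLetters (bT bU zeroLetter V1Letter)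
open Literature.MathematicalPhysics.QuantumFieldTheory.Balaban1983to89.B9Eq375GradLetters (zeroLetter₂ V1Letter₂)
open Literature.MathematicalPhysics.QuantumFieldTheory.Balaban1983to89.B9Eq372RemLetters
open Literature.MathematicalPhysics.QuantumFieldTheory.Balaban1983to89.B9Eq382V3Letters
open Literature.MathematicalPhysics.QuantumFieldTheory.Balaban1983to89.B9Ineq385V3Concrete (cV385)
open Literature.MathematicalPhysics.QuantumFieldTheory.Balaban1983to89.B9Ineq386V3Concrete (thm34_G_entries13_concreteV₃)
open Literature.MathematicalPhysics.QuantumFieldTheory.Balaban1983to89.B9Eq376POneLetters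

/-! ## §1  (3.77) for letters typed between two carriers, through the block embedding -/

section Hom

variable {X Y : Type}

/-- `(0 0; C 0)(A 0; 0 0) = (0 0; CA 0)`: a sites→bonds letter after a sites→sites letter. [folklore] [cite: Balaban1984PropagatorsII, (2.52) p.232] -/
theorem emb₄_C_mul_A (C : (X → ℝ) →ₗ[ℝ] (Y → ℝ)) (A : Module.End ℝ (X → ℝ)) :
    emb₄ 0 0 C 0 * emb₄ A 0 0 0
      = emb₄ (0 : Module.End ℝ (X → ℝ)) (0 : (Y → ℝ) →ₗ[ℝ] (X → ℝ)) (C ∘ₗ A) (0 : Module.End ℝ (Y → ℝ)) := by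
  rw [emb₄_mul]; simp

/-- `(A 0; 0 0)(0 B; 0 0) = (0 AB; 0 0)`: a sites→sites letter after a bonds→sites letter. [folklore] [cite: Balaban1984PropagatorsII, (2.52) p.232] -/
theorem emb₄_A_mul_B (A : Module.End ℝ (X → ℝ)) (B : (Y → ℝ) →ₗ[ℝ] (X → ℝ)) :
    emb₄ A 0 0 0 * emb₄ 0 B 0 0
      = emb₄ (0 : Module.End ℝ (X → ℝ)) (A ∘ₗ B) (0 : (X → ℝ) →ₗ[ℝ] (Y → ℝ)) (0 : Module.End ℝ (Y → ℝ)) := by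
  rw [emb₄_mul]; simp

/-- `(0 0; C 0)(0 B; 0 0) = (0 0; 0 CB)`: sites→bonds after bonds→sites is a letter of the bond carrier. [folklore] [cite: Balaban1984PropagatorsII, (2.52) p.232] -/
theorem emb₄_C_mul_B (C : (X → ℝ) →ₗ[ℝ] (Y → ℝ)) (B : (Y → ℝ) →ₗ[ℝ] (X → ℝ)) :
    emb₄ 0 0 C 0 * emb₄ 0 B 0 0
      = emb₄ (0 : Module.End ℝ (X → ℝ)) (0 : (Y → ℝ) →ₗ[ℝ] (X → ℝ)) (0 : (X → ℝ) →ₗ[ℝ] (Y → ℝ)) (C ∘ₗ B) := by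
  rw [emb₄_mul]; simp

/-- `(0 0; C 0)(A 0; 0 0)(0 B; 0 0) = (0 0; 0 CAB)` — the shape of every word of (3.76). [folklore] [cite: Balaban1984PropagatorsII, (2.52) p.232; Balaban1985BackgroundPropagators, (3.76) p.405] -/
theorem emb₄_C_mul_A_mul_B (C : (X → ℝ) →ₗ[ℝ] (Y → ℝ)) (A : Module.End ℝ (X → ℝ)) (B : (Y → ℝ) →ₗ[ℝ] (X → ℝ)) :
    emb₄ 0 0 C 0 * emb₄ A 0 0 0 * emb₄ 0 B 0 0
      = emb₄ (0 : Module.End ℝ (X → ℝ)) (0 : (Y → ℝ) →ₗ[ℝ] (X → ℝ)) (0 : (X → ℝ) →ₗ[ℝ] (Y → ℝ)) (C ∘ₗ A ∘ₗ B) := by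
  rw [emb₄_C_mul_A, emb₄_mul]; simp [LinearMap.comp_assoc]

/-- **`P₁(A)` OF THE EMBEDDED LETTERS IS THE EMBEDDED TWO-SPACE `P₁(A)`**: `B9Eq386Neumann.pOne (0 0; D 0) (0 0; D′ 0) (0 D*; 0 0) (0 D*′; 0 0)
(P 0; 0 0) (P′ 0; 0 0) = (0 0; 0 P₁)` with `P₁ = (D′−D)PD* + DP(D*′−D*) + (D′−D)P(D*′−D*) + D′P′D*′` typed.
[cite: Balaban1985BackgroundPropagators, (3.76) p.405; Balaban1984PropagatorsII, (2.52) p.232] -/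
theorem pOne_emb₄ (Dc Dc' : (X → ℝ) →ₗ[ℝ] (Y → ℝ)) (Dsc Dsc' : (Y → ℝ) →ₗ[ℝ] (X → ℝ)) (P Pp : Module.End ℝ (X → ℝ)) :
    pOne (emb₄ 0 0 Dc 0) (emb₄ 0 0 Dc' 0) (emb₄ 0 Dsc 0 0) (emb₄ 0 Dsc' 0 0) (emb₄ P 0 0 0) (emb₄ Pp 0 0 0)
      = emb₄ (0 : Module.End ℝ (X → ℝ)) (0 : (Y → ℝ) →ₗ[ℝ] (X → ℝ)) (0 : (X → ℝ) →ₗ[ℝ] (Y → ℝ))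
          ((Dc' - Dc) ∘ₗ P ∘ₗ Dsc + Dc ∘ₗ P ∘ₗ (Dsc' - Dsc) + (Dc' - Dc) ∘ₗ P ∘ₗ (Dsc' - Dsc) + Dc' ∘ₗ Pp ∘ₗ Dsc') := by
  simp only [pOne, emb₄_sub, sub_zero, emb₄_C_mul_A_mul_B, emb₄_add, add_zero]

variable {g : B9.Geometry} [Fintype g.Site] {R : ℝ} {H : Prop}

/-- **(3.77) FOR LETTERS TYPED BETWEEN TWO CARRIERS** (`X` ∋ sites, `Y` ∋ bonds; blocks `blkX`, `blkY`): `B9Ineq377POne.ineq377_op` with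
`D, D′ = D + E : X → Y`, `D*, D*′ = D* + E* : Y → X`, `P = P(U)`, `P′ = P′(A)` letters of `X`, the (3.49)-entries `P`, `DP`, `PD*` (constant `κ_P`),
the (3.68)-entries `P′`, `DP′`, `P′D*`, `DP′D*` (constant `κ_{P′}α₁`) and the first-order letters `E`, `E*` (`c_Eα₁(Lʲη)⁻¹e^{−δd}`) as
(two-space) block majorants of the typed composites, all at one rate `δ`; Lemma 2.1 of [4] at exponent `α` (`ScaleTransfer`, constant `Λ ≧ 1`),
(2.61) at `β`, (2.54), `ρ + 2(α+β)δ₀ ≦ δ`.  CONCLUSION: on the `Y` carrier, `P₁ = (D′−D)PD* + DP(D*′−D*) + (D′−D)P(D*′−D*) + D′P′D*′ ≺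
κ₃₇₇·α₁·(Lʲη)⁻²·e^{−ρd(y,y′)}`, `κ₃₇₇ = B9Ineq377POne.kappa377 c_E κ_P κ_{P′} Λ c₁(β) α₁`.  Proof: embed all letters into `X ⊕ Y` by `emb₄`
(FILE 9), apply `ineq377_op` there, read off the bond block (`pOne_emb₄`, `hasMajorant_of_emb₄_inr_inr`).
[cite: Balaban1985BackgroundPropagators, (3.76)–(3.77) pp.405–406 + (3.49) p.399 + (3.68) p.403; Balaban1984PropagatorsII, Lemma 2.1 p.234 + (2.52)–(2.55) p.232] -/
theorem ineq377_hom (blkX : X → g.Site) (blkY : Y → g.Site) (d : ℕ) (δ₀ δ α β ρ Λ cE κP κP' α₁ : ℝ)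
    (hcE : 0 ≤ cE) (hκP : 0 ≤ κP) (hκP' : 0 ≤ κP') (hα₁ : 0 ≤ α₁) (hΛ : 1 ≤ Λ) (hρ : 0 ≤ ρ) (hα : 0 ≤ α)
    (hβ : 0 ≤ β) (hδ₀ : 0 ≤ δ₀) (hr : ρ + 2 * ((α + β) * δ₀) ≤ δ)
    (hdnn : ∀ a b : g.Site, 0 ≤ g.dist a b) (htri : Triangle254 (toB6 g R H)) (hlen : ∀ y : g.Site, 0 < g.len y)
    (h261 : Ineq261 d (toB6 g R H) δ₀ β) (hT1i : ScaleTransfer g δ₀ α Λ (fun a => (g.len a)⁻¹))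
    {Dc Dc' Ec : (X → ℝ) →ₗ[ℝ] (Y → ℝ)} {Dsc Dsc' Esc : (Y → ℝ) →ₗ[ℝ] (X → ℝ)} {P Pp : Module.End ℝ (X → ℝ)}
    (hD' : Dc' = Dc + Ec) (hDs' : Dsc' = Dsc + Esc)
    (hP : HasMajorant (g := toB6 g R H) blkX P (fun a b => κP * Real.exp (-(δ * g.dist a b))))
    (hDP : HasMajorantHom (g := toB6 g R H) blkX blkY (Dc ∘ₗ P)
      (fun a b => κP * (g.len a)⁻¹ * Real.exp (-(δ * g.dist a b))))
    (hPDs : HasMajorantHom (g := toB6 g R H) blkY blkX (P ∘ₗ Dsc)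
      (fun a b => κP * (g.len a)⁻¹ * Real.exp (-(δ * g.dist a b))))
    (hPp : HasMajorant (g := toB6 g R H) blkX Pp (fun a b => κP' * α₁ * Real.exp (-(δ * g.dist a b))))
    (hDPp : HasMajorantHom (g := toB6 g R H) blkX blkY (Dc ∘ₗ Pp)
      (fun a b => κP' * α₁ * (g.len a)⁻¹ * Real.exp (-(δ * g.dist a b))))
    (hPpDs : HasMajorantHom (g := toB6 g R H) blkY blkX (Pp ∘ₗ Dsc)
      (fun a b => κP' * α₁ * (g.len a)⁻¹ * Real.exp (-(δ * g.dist a b))))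
    (hDPpDs : HasMajorant (g := toB6 g R H) blkY (Dc ∘ₗ Pp ∘ₗ Dsc)
      (fun a b => κP' * α₁ * (g.len a ^ 2)⁻¹ * Real.exp (-(δ * g.dist a b))))
    (hE : HasMajorantHom (g := toB6 g R H) blkX blkY Ec (fun a b => cE * α₁ * (g.len a)⁻¹ * Real.exp (-(δ * g.dist a b))))
    (hEs : HasMajorantHom (g := toB6 g R H) blkY blkX Esc (fun a b => cE * α₁ * (g.len a)⁻¹ * Real.exp (-(δ * g.dist a b)))) :
    HasMajorant (g := toB6 g R H) blkY
      ((Dc' - Dc) ∘ₗ P ∘ₗ Dsc + Dc ∘ₗ P ∘ₗ (Dsc' - Dsc) + (Dc' - Dc) ∘ₗ P ∘ₗ (Dsc' - Dsc) + Dc' ∘ₗ Pp ∘ₗ Dsc')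
      (fun a b => kappa377 cE κP κP' Λ (B6.c1 d δ₀ β) α₁ * α₁ * (g.len a ^ 2)⁻¹ * Real.exp (-(ρ * g.dist a b))) := by
  have hw1 : ∀ a : g.Site, 0 ≤ (g.len a)⁻¹ := fun a => inv_nonneg.mpr (hlen a).le
  have hw2 : ∀ a : g.Site, 0 ≤ (g.len a ^ 2)⁻¹ := fun a => inv_nonneg.mpr (sq_nonneg _)
  have hK0 : ∀ a b : g.Site, 0 ≤ κP * Real.exp (-(δ * g.dist a b)) := fun a b => by positivity
  have hK1 : ∀ a b : g.Site, 0 ≤ κP * (g.len a)⁻¹ * Real.exp (-(δ * g.dist a b)) := fun a b => by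
    have := hw1 a; positivity
  have hK2 : ∀ a b : g.Site, 0 ≤ κP' * α₁ * Real.exp (-(δ * g.dist a b)) := fun a b => by positivity
  have hK3 : ∀ a b : g.Site, 0 ≤ κP' * α₁ * (g.len a)⁻¹ * Real.exp (-(δ * g.dist a b)) := fun a b => by
    have := hw1 a; positivity
  have hK4 : ∀ a b : g.Site, 0 ≤ κP' * α₁ * (g.len a ^ 2)⁻¹ * Real.exp (-(δ * g.dist a b)) := fun a b => by
    have := hw2 a; positivity
  have hK5 : ∀ a b : g.Site, 0 ≤ cE * α₁ * (g.len a)⁻¹ * Real.exp (-(δ * g.dist a b)) := fun a b => by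
    have := hw1 a; positivity
  -- the letters on the sum carrier `X ⊕ Y` and their majorants
  have hPW := hasMajorant_emb₄_inl_inl (g := toB6 g R H) (blkY := blkY) hP hK0
  have hDPW : HasMajorant (g := toB6 g R H) (Sum.elim blkX blkY)
      (emb₄ 0 0 Dc 0 * emb₄ P (0 : (Y → ℝ) →ₗ[ℝ] (X → ℝ)) (0 : (X → ℝ) →ₗ[ℝ] (Y → ℝ)) 0)
      (fun a b => κP * (g.len a)⁻¹ * Real.exp (-(δ * g.dist a b))) := by
    rw [emb₄_C_mul_A]; exact hasMajorant_emb₄_inr_inl hDP hK1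
  have hPDsW : HasMajorant (g := toB6 g R H) (Sum.elim blkX blkY)
      (emb₄ P (0 : (Y → ℝ) →ₗ[ℝ] (X → ℝ)) (0 : (X → ℝ) →ₗ[ℝ] (Y → ℝ)) 0 * emb₄ 0 Dsc 0 0)
      (fun a b => κP * (g.len a)⁻¹ * Real.exp (-(δ * g.dist a b))) := by
    rw [emb₄_A_mul_B]; exact hasMajorant_emb₄_inl_inr hPDs hK1
  have hPpW := hasMajorant_emb₄_inl_inl (g := toB6 g R H) (blkY := blkY) hPp hK2
  have hDPpW : HasMajorant (g := toB6 g R H) (Sum.elim blkX blkY)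
      (emb₄ 0 0 Dc 0 * emb₄ Pp (0 : (Y → ℝ) →ₗ[ℝ] (X → ℝ)) (0 : (X → ℝ) →ₗ[ℝ] (Y → ℝ)) 0)
      (fun a b => κP' * α₁ * (g.len a)⁻¹ * Real.exp (-(δ * g.dist a b))) := by
    rw [emb₄_C_mul_A]; exact hasMajorant_emb₄_inr_inl hDPp hK3
  have hPpDsW : HasMajorant (g := toB6 g R H) (Sum.elim blkX blkY)
      (emb₄ Pp (0 : (Y → ℝ) →ₗ[ℝ] (X → ℝ)) (0 : (X → ℝ) →ₗ[ℝ] (Y → ℝ)) 0 * emb₄ 0 Dsc 0 0)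
      (fun a b => κP' * α₁ * (g.len a)⁻¹ * Real.exp (-(δ * g.dist a b))) := by
    rw [emb₄_A_mul_B]; exact hasMajorant_emb₄_inl_inr hPpDs hK3
  have hDPpDsW : HasMajorant (g := toB6 g R H) (Sum.elim blkX blkY)
      (emb₄ 0 0 Dc 0 * emb₄ Pp (0 : (Y → ℝ) →ₗ[ℝ] (X → ℝ)) (0 : (X → ℝ) →ₗ[ℝ] (Y → ℝ)) 0 * emb₄ 0 Dsc 0 0)
      (fun a b => κP' * α₁ * (g.len a ^ 2)⁻¹ * Real.exp (-(δ * g.dist a b))) := by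
    rw [emb₄_C_mul_A_mul_B]; exact hasMajorant_emb₄_inr_inr hDPpDs hK4
  have hEW := hasMajorant_emb₄_inr_inl (g := toB6 g R H) hE hK5
  have hEsW := hasMajorant_emb₄_inl_inr (g := toB6 g R H) hEs hK5
  have hD'W : emb₄ (0 : Module.End ℝ (X → ℝ)) (0 : (Y → ℝ) →ₗ[ℝ] (X → ℝ)) Dc' (0 : Module.End ℝ (Y → ℝ))
      = emb₄ 0 0 Dc 0 + emb₄ 0 0 Ec 0 := by
    rw [emb₄_add, hD']; simp
  have hDs'W : emb₄ (0 : Module.End ℝ (X → ℝ)) Dsc' (0 : (X → ℝ) →ₗ[ℝ] (Y → ℝ)) (0 : Module.End ℝ (Y → ℝ))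
      = emb₄ 0 Dsc 0 0 + emb₄ 0 Esc 0 0 := by
    rw [emb₄_add, hDs']; simp
  have h := ineq377_op (R := R) (H := H) (Sum.elim blkX blkY) d δ₀ δ α β ρ Λ cE κP κP' α₁ hcE hκP hκP' hα₁ hΛ hρ hα hβ hδ₀ hr
    hdnn htri hlen h261 hT1i hD'W hDs'W hPW hDPW hPDsW hPpW hDPpW hPpDsW hDPpDsW hEW hEsW
  rw [pOne_emb₄] at h
  exact hasMajorant_of_emb₄_inr_inr h

end Hom

/-! ## §2  (3.77) with the differential letters concrete -/

section Concrete

variable {𝔸 : Type*} [NormedRing 𝔸] [NormedAlgebra ℂ 𝔸] [CompleteSpace 𝔸] {ι : Type} [Fintype ι]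
variable (b : Module.Basis ι ℝ 𝔸) {S : Type} {κ : Type} [Fintype κ]
variable (T : κ → Equiv.Perm S) (U : κ → S → 𝔸ˣ)
variable {g : B9.Geometry} [Fintype g.Site] {Rr : ℝ} {H : Prop}

/-- **(3.77) FOR THE CONCRETE DIFFERENTIAL LETTERS OF (3.76)**: with `D := conjHom b (η⁻¹D¹_U)`, `D′ := conjHom b (η⁻¹D¹_{U′U})` (sites → bonds),
`D* := conjHom b (η⁻¹Σ_νD¹*_{U,ν})`, `D*′` (bonds → sites) of FILE 10 and ANY site-carrier letters `P = P(U)`, `P′ = P′(A)` with the typed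
(3.49)/(3.68) entries at a rate `δ`: under (3.37) blockwise (`‖A_k(x)‖, ‖(τ*_νA_ν)(x)‖ ≦ α₁(L^{j(y(x))}η)⁻¹`), `η·α₁(Lʲη)⁻¹ ≦ 1/4`, a group-valued
background, `|b.repr w i| ≦ M₂‖w‖`, the neighbour geometry `d(y(x), y(x ± e_μ)) ≦ d₀` and the located devices' geometry ((2.54), (2.61) at `β`,
Lemma 2.1 at `α` with `Λ ≧ 1`, `ρ + 2(α+β)δ₀ ≦ δ`):
`P₁(A) = (D′−D)PD* + DP(D*′−D*) + (D′−D)P(D*′−D*) + D′P′D*′ ≺ κ₃₇₇(c_E, κ_P, κ_{P′}, Λ, c₁(β), α₁)·α₁·(Lʲη)⁻²·e^{−ρd(y,y′)}` on the bond carrier,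
`c_E = 4(1 + card κ)·M₂Σ_i‖b_i‖·e^{δd₀}` (FILE 10's sizes of `D_{U′U} − D_U`, `D*_{U′U} − D*_U`).
[cite: Balaban1985BackgroundPropagators, (3.76)–(3.77) pp.405–406 + (3.70)/(3.74) pp.404–405 + (3.37) p.396 + (3.49) p.399 + (3.68) p.403; Balaban1984PropagatorsII, Lemma 2.1 p.234 + (2.51)–(2.55) p.232] -/
theorem ineq377_concreteE (blk : S → g.Site) (d : ℕ) (δ₀ δ α β ρ Λ κP κP' α₁ d₀ M₂ : ℝ)
    (hκP : 0 ≤ κP) (hκP' : 0 ≤ κP') (hα₁ : 0 ≤ α₁) (hΛ : 1 ≤ Λ) (hρ : 0 ≤ ρ) (hα : 0 ≤ α) (hβ : 0 ≤ β) (hδ₀ : 0 ≤ δ₀)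
    (hδ : 0 ≤ δ) (hM₂ : 0 ≤ M₂) (hr : ρ + 2 * ((α + β) * δ₀) ≤ δ)
    (hdnn : ∀ a a' : g.Site, 0 ≤ g.dist a a') (htri : Triangle254 (toB6 g Rr H)) (hlen : ∀ y : g.Site, 0 < g.len y)
    (h261 : Ineq261 d (toB6 g Rr H) δ₀ β) (hT1i : ScaleTransfer g δ₀ α Λ (fun a => (g.len a)⁻¹))
    (hrepr : ∀ (w : 𝔸) (i : ι), |b.repr w i| ≤ M₂ * ‖w‖) {η : ℝ} (hη : 0 < η)
    (hU1 : ∀ m z, ‖((U m z : 𝔸ˣ) : 𝔸)‖ ≤ 1 ∧ ‖(((U m z)⁻¹ : 𝔸ˣ) : 𝔸)‖ ≤ 1) (A : κ → S → 𝔸)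
    (hA : ∀ k x, ‖A k x‖ ≤ α₁ * (g.len (blk x))⁻¹) (hAτB : ∀ ν x, ‖tauB T U ν (A ν) x‖ ≤ α₁ * (g.len (blk x))⁻¹)
    (hsmall : ∀ y : g.Site, η * (α₁ * (g.len y)⁻¹) ≤ 1 / 4)
    (hd₀F : ∀ μ x, g.dist (blk x) (blk (T μ x)) ≤ d₀) (hd₀B : ∀ ν x, g.dist (blk x) (blk ((T ν).symm x)) ≤ d₀)
    {P Pp : Module.End ℝ (S × ι → ℝ)}
    (hP : HasMajorant (g := toB6 g Rr H) (fun p : S × ι => blk p.1) P (fun a a' => κP * Real.exp (-(δ * g.dist a a'))))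
    (hDP : HasMajorantHom (g := toB6 g Rr H) (fun p : S × ι => blk p.1) (fun q : (κ × S) × ι => blk q.1.2)
      (conjHom b (gradLin T ((η : ℂ)⁻¹) U) ∘ₗ P) (fun a a' => κP * (g.len a)⁻¹ * Real.exp (-(δ * g.dist a a'))))
    (hPDs : HasMajorantHom (g := toB6 g Rr H) (fun q : (κ × S) × ι => blk q.1.2) (fun p : S × ι => blk p.1)
      (P ∘ₗ conjHom b (divLin T ((η : ℂ)⁻¹) U)) (fun a a' => κP * (g.len a)⁻¹ * Real.exp (-(δ * g.dist a a'))))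
    (hPp : HasMajorant (g := toB6 g Rr H) (fun p : S × ι => blk p.1) Pp (fun a a' => κP' * α₁ * Real.exp (-(δ * g.dist a a'))))
    (hDPp : HasMajorantHom (g := toB6 g Rr H) (fun p : S × ι => blk p.1) (fun q : (κ × S) × ι => blk q.1.2)
      (conjHom b (gradLin T ((η : ℂ)⁻¹) U) ∘ₗ Pp) (fun a a' => κP' * α₁ * (g.len a)⁻¹ * Real.exp (-(δ * g.dist a a'))))
    (hPpDs : HasMajorantHom (g := toB6 g Rr H) (fun q : (κ × S) × ι => blk q.1.2) (fun p : S × ι => blk p.1)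
      (Pp ∘ₗ conjHom b (divLin T ((η : ℂ)⁻¹) U)) (fun a a' => κP' * α₁ * (g.len a)⁻¹ * Real.exp (-(δ * g.dist a a'))))
    (hDPpDs : HasMajorant (g := toB6 g Rr H) (fun q : (κ × S) × ι => blk q.1.2)
      (conjHom b (gradLin T ((η : ℂ)⁻¹) U) ∘ₗ Pp ∘ₗ conjHom b (divLin T ((η : ℂ)⁻¹) U))
      (fun a a' => κP' * α₁ * (g.len a ^ 2)⁻¹ * Real.exp (-(δ * g.dist a a')))) :
    HasMajorant (g := toB6 g Rr H) (fun q : (κ × S) × ι => blk q.1.2)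
      ((conjHom b (gradLin T ((η : ℂ)⁻¹) (prodCfg U η A)) - conjHom b (gradLin T ((η : ℂ)⁻¹) U)) ∘ₗ P
            ∘ₗ conjHom b (divLin T ((η : ℂ)⁻¹) U)
        + conjHom b (gradLin T ((η : ℂ)⁻¹) U) ∘ₗ P
            ∘ₗ (conjHom b (divLin T ((η : ℂ)⁻¹) (prodCfg U η A)) - conjHom b (divLin T ((η : ℂ)⁻¹) U))
        + (conjHom b (gradLin T ((η : ℂ)⁻¹) (prodCfg U η A)) - conjHom b (gradLin T ((η : ℂ)⁻¹) U)) ∘ₗ P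
            ∘ₗ (conjHom b (divLin T ((η : ℂ)⁻¹) (prodCfg U η A)) - conjHom b (divLin T ((η : ℂ)⁻¹) U))
        + conjHom b (gradLin T ((η : ℂ)⁻¹) (prodCfg U η A)) ∘ₗ Pp ∘ₗ conjHom b (divLin T ((η : ℂ)⁻¹) (prodCfg U η A)))
      (fun a a' => kappa377 (4 * (1 + Fintype.card κ) * (M₂ * ∑ i, ‖b i‖) * Real.exp (δ * d₀)) κP κP' Λ (B6.c1 d δ₀ β) α₁
        * α₁ * (g.len a ^ 2)⁻¹ * Real.exp (-(ρ * g.dist a a'))) := by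
  set M : ℝ := M₂ * ∑ i, ‖b i‖ with hM
  have hbsum : 0 ≤ ∑ i, ‖b i‖ := Finset.sum_nonneg fun i _ => norm_nonneg _
  have hM0 : 0 ≤ M := mul_nonneg hM₂ hbsum
  have hcard : (0 : ℝ) ≤ Fintype.card κ := Nat.cast_nonneg _
  have hcE : 0 ≤ 4 * (1 + Fintype.card κ) * M * Real.exp (δ * d₀) := by positivity
  have hw1 : ∀ a : g.Site, 0 ≤ (g.len a)⁻¹ := fun a => inv_nonneg.mpr (hlen a).le
  -- FILE 10's sizes of the first-order letters, weakened to the common constant `c_E`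
  have hE₀ := hasMajorantHom_gradLin_sub (Rr := Rr) (H := H) T U b blk hη hU1 A d₀ δ M₂ α₁ hα₁ hδ hM₂ hrepr hlen hA hsmall hd₀F
  have hEs₀ := hasMajorantHom_divLin_sub (Rr := Rr) (H := H) T U b blk hη hU1 A d₀ δ M₂ α₁ hα₁ hδ hM₂ hrepr hlen hAτB hsmall hd₀B
  have hE : HasMajorantHom (g := toB6 g Rr H) (fun p : S × ι => blk p.1) (fun q : (κ × S) × ι => blk q.1.2)
      (conjHom b (gradLin T ((η : ℂ)⁻¹) (prodCfg U η A)) - conjHom b (gradLin T ((η : ℂ)⁻¹) U))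
      (fun a a' => 4 * (1 + Fintype.card κ) * M * Real.exp (δ * d₀) * α₁ * (g.len a)⁻¹ * Real.exp (-(δ * g.dist a a'))) := by
    rw [← conjHom_sub]
    refine hasMajorantHom_mono _ _ hE₀ fun a a' => ?_
    have h0 : 0 ≤ M * Real.exp (δ * d₀) * α₁ * (g.len a)⁻¹ * Real.exp (-(δ * g.dist a a')) := by
      have := hw1 a; positivity
    nlinarith
  have hEs : HasMajorantHom (g := toB6 g Rr H) (fun q : (κ × S) × ι => blk q.1.2) (fun p : S × ι => blk p.1)
      (conjHom b (divLin T ((η : ℂ)⁻¹) (prodCfg U η A)) - conjHom b (divLin T ((η : ℂ)⁻¹) U))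
      (fun a a' => 4 * (1 + Fintype.card κ) * M * Real.exp (δ * d₀) * α₁ * (g.len a)⁻¹ * Real.exp (-(δ * g.dist a a'))) := by
    rw [← conjHom_sub]
    refine hasMajorantHom_mono _ _ hEs₀ fun a a' => ?_
    have h0 : 0 ≤ M * Real.exp (δ * d₀) * α₁ * (g.len a)⁻¹ * Real.exp (-(δ * g.dist a a')) := by
      have := hw1 a; positivity
    nlinarith
  exact ineq377_hom (R := Rr) (H := H) (fun p : S × ι => blk p.1) (fun q : (κ × S) × ι => blk q.1.2) d δ₀ δ α β ρ Λ
    (4 * (1 + Fintype.card κ) * M * Real.exp (δ * d₀)) κP κP' α₁ hcE hκP hκP' hα₁ hΛ hρ hα hβ hδ₀ hr hdnn htri hlen h261 hT1i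
    (add_sub_cancel _ _).symm (add_sub_cancel _ _).symm hP hDP hPDs hPp hDPp hPpDs hDPpDs hE hEs

end Concrete

/-! ## §3  Theorem 3.4's `G`-clause, entries (3.42)₁ and (3.42)₃, with `V₃(A)` AND `P₁(A)` concrete -/

section Assembly

variable {𝔸 : Type*} [NormedRing 𝔸] [NormedAlgebra ℂ 𝔸] [CompleteSpace 𝔸] {ι : Type} [Fintype ι]
variable (b : Module.Basis ι ℝ 𝔸) {S : Type} {κ : Type} [Fintype κ] [LinearOrder κ]
variable (T : κ → Equiv.Perm S) (U : κ → S → 𝔸ˣ)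
variable {g : B9.Geometry} [Fintype g.Site] {Rr : ℝ} {H : Prop}

/-- **THEOREM 3.4, `G`-CLAUSE, ENTRIES (3.42)₁ AND (3.42)₃, FOR THE CONCRETE `V₃(A)` OF (3.82) AND THE CONCRETE `P₁(A)` OF (3.76)**: file 8's
`B9Ineq386V3Concrete.thm34_G_entries13_concreteV₃` with its two `P₁`-hypotheses DISCHARGED — `h376` by FILE 10's `eq376_concrete` (so `DRD* =
D∘(1 − P)∘D*` and `D′R′D′* = D′∘(1 − (P + P′))∘D′*` are the concrete words of the two-space letters `D = conjHom b (η⁻¹D¹_U)`, `D′ = conjHom b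
(η⁻¹D¹_{U′U})`, `D*`, `D*′`, with `P = P(U)`, `P′ = P′(A)` abstract letters of the site carrier) and `hP₁` by §2 (`κ₁ = κ₃₇₇(c_E, κ_P, κ_{P′}, Λ, c₁(β),
α₁)`, `c_E = 4(1 + card κ)M₂Σ_i‖b_i‖e^{δ_Pd₀}`, the typed (3.49)/(3.68) entries of `P`, `P′` entering at a rate `δ_P ≧ δ + 2(α+β)δ₀`).  All other
inputs as in file 8 (commuting shifts; group-valued background with (3.35) through each bond; (3.37) blockwise; `η = g.eta > 0`, `L ≧ 1`,
`ηα₁(Lʲη)⁻¹ ≦ 1/4`; stencil geometry; located devices' geometry/rates with `Λ ≧ 1`; abstract `P₂` with (3.83), (3.80); `Δ_a(U)G(U) = G(U)Δ_a(U) = 1`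
for the concrete `DRD*`; Theorem 3.3's entries for `G(U)`; the smallness `κ₃₈₅′α₁c₁(α′) < 1`).  CONCLUSION: a two-sided inverse `G(U′U)` of
`Δ_a(U′U)` with `G(U′U) ≺ B₀c₁(α′)(1 − κ₃₈₅′α₁c₁(α′))⁻¹(Lʲη)²e^{−(1−α′)ρd}` and `G(U′U)·∇* ≺ B₀Λ_ρ²c₁(α′)(1 − κ₃₈₅′α₁c₁(α′))⁻¹Lʲη·e^{−(1−3α′)ρd}`.
[cite: Balaban1985BackgroundPropagators, Thm 3.4 p.400 + (3.76)–(3.77) pp.405–406 + (3.82)–(3.86) p.407 + (3.49) p.399 + (3.68) p.403 + (3.37)/(3.35) p.396; Balaban1984PropagatorsII, (2.66) p.234 + Lemma 2.1 p.234 + (2.51)–(2.55) p.232; Balaban1985Variational, (135) p.298] -/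
theorem thm34_G_entries13_concreteV₃P₁ [Fintype S] [DecidableEq S] [DecidableEq ι] (blk : S → g.Site) (d : ℕ)
    (δ₀ δ δP α β ρ α' Λ Λρ B₀ κP κP' κ₁ κ₂ α₁ C₀ d₀ M₂ : ℝ)
    (hB₀ : 0 ≤ B₀) (hκP : 0 ≤ κP) (hκP' : 0 ≤ κP') (hκ₂ : 0 ≤ κ₂) (hα₁ : 0 ≤ α₁) (hC₀ : 0 ≤ C₀) (hΛ : 1 ≤ Λ) (hΛρ : 0 ≤ Λρ)
    (hρ : 0 ≤ ρ) (hα : 0 ≤ α) (hβ : 0 ≤ β) (hδ₀ : 0 ≤ δ₀) (hδ : 0 ≤ δ) (hM₂ : 0 ≤ M₂) (hr : ρ + (α + β) * δ₀ ≤ δ)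
    (hrP : δ + 2 * ((α + β) * δ₀) ≤ δP) (hα' : α' ≤ 1) (hα'ρ0 : 0 ≤ α' * ρ) (hα'ρ2 : 0 ≤ (1 - 2 * α') * ρ)
    (hκ₁ : κ₁ = kappa377 (4 * (1 + Fintype.card κ) * (M₂ * ∑ i, ‖b i‖) * Real.exp (δP * d₀)) κP κP' Λ (B6.c1 d δ₀ β) α₁)
    (hdnn : ∀ a a' : g.Site, 0 ≤ g.dist a a') (htri : Triangle254 (toB6 g Rr H)) (hrefl : ∀ y : g.Site, g.dist y y = 0)
    (hsym : ∀ y y' : g.Site, g.dist y y' = g.dist y' y) (hlen : ∀ y : g.Site, 0 < g.len y)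
    (h261 : Ineq261 d (toB6 g Rr H) δ₀ β) (h261' : Ineq261 d (toB6 g Rr H) ρ α')
    (hT1 : ScaleTransfer g δ₀ α Λ (fun a => g.len a)) (hT2 : ScaleTransfer g δ₀ α Λ (fun a => g.len a ^ 2))
    (hT1i : ScaleTransfer g δ₀ α Λ (fun a => (g.len a)⁻¹)) (hT2i : ScaleTransfer g δ₀ α Λ (fun a => (g.len a ^ 2)⁻¹))
    (hTρ : ScaleTransfer g ρ α' Λρ (fun a => g.len a))
    (hsmall385 : kappa385 B₀
        (cV385 (Fintype.card κ) α₁ C₀ (M₂ * (∑ i, ‖b i‖) * Real.exp (δ * d₀))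
          + ∑ _k ∈ (Finset.univ : Finset (κ ⊕ κ)),
            (10 + 8 * Fintype.card κ + (16 * Fintype.card κ + 12) * C₀) * (M₂ * (∑ i, ‖b i‖) * Real.exp (δ * d₀)))
        κ₁ κ₂ Λ (B6.c1 d δ₀ β) * α₁ * B6.c1 d ρ α' < 1)
    (hrepr : ∀ (v : 𝔸) (i : ι), |b.repr v i| ≤ M₂ * ‖v‖) (hη : 0 < g.eta) (hL : 1 ≤ g.L) (A : κ → S → 𝔸)
    (hT : ∀ (μ ν : κ) (x : S), T μ (T ν x) = T ν (T μ x))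
    (hsmall : ∀ y : g.Site, g.eta * (α₁ * (g.len y)⁻¹) ≤ 1 / 4)
    (hU1 : ∀ m z, ‖((U m z : 𝔸ˣ) : 𝔸)‖ ≤ 1 ∧ ‖(((U m z)⁻¹ : 𝔸ˣ) : 𝔸)‖ ≤ 1)
    -- (3.37) for the exponent field, blockwise, in the shapes files 1–10 read it
    (h337B : ∀ ν k x, ‖((g.eta : ℂ)⁻¹) • covDstar T U ν (A k) x‖ ≤ α₁ * (g.len (blk x) ^ 2)⁻¹)
    (h337F : ∀ μ ν x, ‖((g.eta : ℂ)⁻¹) • covD T U μ (A ν) x‖ ≤ α₁ * (g.len (blk x) ^ 2)⁻¹)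
    (h337B' : ∀ μ ν x, ‖((g.eta : ℂ)⁻¹) • covDstar T U ν (A ν) (T μ x)‖ ≤ α₁ * (g.len (blk x) ^ 2)⁻¹)
    (h337Bτ : ∀ μ x, ‖((g.eta : ℂ)⁻¹) • covDstar T U μ (tauB T U μ (A μ)) x‖ ≤ α₁ * (g.len (blk x) ^ 2)⁻¹)
    (h337FB : ∀ μ ν k x, ‖((g.eta : ℂ)⁻¹) • covD T U μ (A k) ((T ν).symm x)‖ ≤ α₁ * (g.len (blk x) ^ 2)⁻¹)
    (hA : ∀ k x, ‖A k x‖ ≤ α₁ * (g.len (blk x))⁻¹) (hAτB : ∀ ν k x, ‖tauB T U ν (A k) x‖ ≤ α₁ * (g.len (blk x))⁻¹)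
    (hAτF : ∀ μ k x, ‖tauF T U μ (A k) x‖ ≤ α₁ * (g.len (blk x))⁻¹)
    (hAFB : ∀ k μ ν x, ‖A k ((T ν).symm (T μ x))‖ ≤ α₁ * (g.len (blk x))⁻¹)
    (hAst : ∀ μ x m z, (m, z) ∈ stBonds T μ x → ‖A m z‖ ≤ α₁ * (g.len (blk x))⁻¹)
    (hAloc : ∀ μ x m z, (m, z) ∈ B9Eq375Locality.locBondsA T μ x → ‖A m z‖ ≤ α₁ * (g.len (blk x))⁻¹)
    (hdAst : ∀ μ x m n y, Through T μ x m n y →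
      ‖covD T U m (A n) y‖ ≤ g.eta * (α₁ * ((g.len (blk x))⁻¹) ^ 2) ∧
        ‖covD T U n (A m) y‖ ≤ g.eta * (α₁ * ((g.len (blk x))⁻¹) ^ 2))
    -- (3.35) on the plaquettes through each bond, at that bond's block scale
    (h35 : ∀ μ x m n y, Through T μ x m n y → ‖(plaqU T U m n y : 𝔸) - 1‖ ≤ C₀ * ((g.L ^ g.scale (blk x))⁻¹) ^ 2)
    -- stencil geometry
    (hd₀B : ∀ μ x, g.dist (blk x) (blk ((T μ).symm x)) ≤ d₀) (hd₀F : ∀ μ x, g.dist (blk x) (blk (T μ x)) ≤ d₀)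
    (hd₀FB : ∀ μ ν x, g.dist (blk x) (blk ((T ν).symm (T μ x))) ≤ d₀)
    (hd₀st : ∀ μ x (q : κ × S), q ∈ stBonds T μ x → g.dist (blk x) (blk q.2) ≤ d₀)
    (hd₀loc : ∀ μ x (q : κ × S), q ∈ B9Eq375Locality.locBondsA' T μ x → g.dist (blk x) (blk q.2) ≤ d₀)
    (hd₀0 : ∀ y : g.Site, g.dist y y ≤ d₀)
    -- the projection letters `P = P(U)`, `P′ = P′(A)` of the site carrier and their typed (3.49)/(3.68) entries at the rate `δ_P`
    {P Pp : Module.End ℝ (S × ι → ℝ)}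
    (hP : HasMajorant (g := toB6 g Rr H) (fun p : S × ι => blk p.1) P (fun a a' => κP * Real.exp (-(δP * g.dist a a'))))
    (hDP : HasMajorantHom (g := toB6 g Rr H) (fun p : S × ι => blk p.1) (fun q : (κ × S) × ι => blk q.1.2)
      (conjHom b (gradLin T ((g.eta : ℂ)⁻¹) U) ∘ₗ P) (fun a a' => κP * (g.len a)⁻¹ * Real.exp (-(δP * g.dist a a'))))
    (hPDs : HasMajorantHom (g := toB6 g Rr H) (fun q : (κ × S) × ι => blk q.1.2) (fun p : S × ι => blk p.1)
      (P ∘ₗ conjHom b (divLin T ((g.eta : ℂ)⁻¹) U)) (fun a a' => κP * (g.len a)⁻¹ * Real.exp (-(δP * g.dist a a'))))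
    (hPp : HasMajorant (g := toB6 g Rr H) (fun p : S × ι => blk p.1) Pp
      (fun a a' => κP' * α₁ * Real.exp (-(δP * g.dist a a'))))
    (hDPp : HasMajorantHom (g := toB6 g Rr H) (fun p : S × ι => blk p.1) (fun q : (κ × S) × ι => blk q.1.2)
      (conjHom b (gradLin T ((g.eta : ℂ)⁻¹) U) ∘ₗ Pp) (fun a a' => κP' * α₁ * (g.len a)⁻¹ * Real.exp (-(δP * g.dist a a'))))
    (hPpDs : HasMajorantHom (g := toB6 g Rr H) (fun q : (κ × S) × ι => blk q.1.2) (fun p : S × ι => blk p.1)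
      (Pp ∘ₗ conjHom b (divLin T ((g.eta : ℂ)⁻¹) U)) (fun a a' => κP' * α₁ * (g.len a)⁻¹ * Real.exp (-(δP * g.dist a a'))))
    (hDPpDs : HasMajorant (g := toB6 g Rr H) (fun q : (κ × S) × ι => blk q.1.2)
      (conjHom b (gradLin T ((g.eta : ℂ)⁻¹) U) ∘ₗ Pp ∘ₗ conjHom b (divLin T ((g.eta : ℂ)⁻¹) U))
      (fun a a' => κP' * α₁ * (g.len a ^ 2)⁻¹ * Real.exp (-(δP * g.dist a a'))))
    -- the abstract data of (3.80), the inverse property for the concrete `DRD*` and Theorem 3.3 for G(U)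
    {G Ds P₂ Qs Qs' Q Q' a F₂ F₂s : Module.End ℝ ((κ × S) × ι → ℝ)}
    (h380 : Q' = Q + F₂) (h380s : Qs' = Qs + F₂s) (hP₂def : P₂ = pTwo Qs Q F₂ F₂s a)
    (hΔG : deltaA (conj b (lapDDLetter T ((g.eta : ℂ)⁻¹) U)) (conj b (dPrimeLetter T U g.eta))
      (conjHom b (gradLin T ((g.eta : ℂ)⁻¹) U) ∘ₗ (1 - P) ∘ₗ conjHom b (divLin T ((g.eta : ℂ)⁻¹) U)) Qs a Q * G = 1)
    (hGΔ : G * deltaA (conj b (lapDDLetter T ((g.eta : ℂ)⁻¹) U)) (conj b (dPrimeLetter T U g.eta))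
      (conjHom b (gradLin T ((g.eta : ℂ)⁻¹) U) ∘ₗ (1 - P) ∘ₗ conjHom b (divLin T ((g.eta : ℂ)⁻¹) U)) Qs a Q = 1)
    (hP₂ : HasMajorant (g := toB6 g Rr H) (fun q : (κ × S) × ι => blk q.1.2) P₂
      (fun a a' => κ₂ * α₁ * (g.len a ^ 2)⁻¹ * Real.exp (-(δ * g.dist a a'))))
    (hG : HasMajorant (g := toB6 g Rr H) (fun q : (κ × S) × ι => blk q.1.2) G
      (fun a a' => B₀ * g.len a ^ 2 * Real.exp (-(δ * g.dist a a'))))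
    (hDG : ∀ k : κ ⊕ κ, HasMajorant (g := toB6 g Rr H) (fun q : (κ × S) × ι => blk q.1.2)
      (conj b (diffLetter (bT T) (bU U) ((g.eta : ℂ)⁻¹) k) * G) (fun a a' => B₀ * g.len a * Real.exp (-(δ * g.dist a a'))))
    (hGD : ∀ k : κ ⊕ κ, HasMajorant (g := toB6 g Rr H) (fun q : (κ × S) × ι => blk q.1.2)
      (G * conj b (diffLetter (bT T) (bU U) ((g.eta : ℂ)⁻¹) k)) (fun a a' => B₀ * g.len a * Real.exp (-(δ * g.dist a a'))))
    (hGDs : HasMajorant (g := toB6 g Rr H) (fun q : (κ × S) × ι => blk q.1.2) (G * Ds)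
      (fun a a' => B₀ * g.len a * Real.exp (-(δ * g.dist a a')))) :
    ∃ GExt : Module.End ℝ ((κ × S) × ι → ℝ),
      deltaA (conj b (lapDDLetter T ((g.eta : ℂ)⁻¹) (prodCfg U g.eta A)))
          (conj b (dPrimeLetter T (prodCfg U g.eta A) g.eta))
          (conjHom b (gradLin T ((g.eta : ℂ)⁻¹) (prodCfg U g.eta A)) ∘ₗ (1 - (P + Pp))
            ∘ₗ conjHom b (divLin T ((g.eta : ℂ)⁻¹) (prodCfg U g.eta A))) Qs' a Q' * GExt = 1 ∧
      GExt * deltaA (conj b (lapDDLetter T ((g.eta : ℂ)⁻¹) (prodCfg U g.eta A)))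
          (conj b (dPrimeLetter T (prodCfg U g.eta A) g.eta))
          (conjHom b (gradLin T ((g.eta : ℂ)⁻¹) (prodCfg U g.eta A)) ∘ₗ (1 - (P + Pp))
            ∘ₗ conjHom b (divLin T ((g.eta : ℂ)⁻¹) (prodCfg U g.eta A))) Qs' a Q' = 1 ∧
      HasMajorant (g := toB6 g Rr H) (fun q : (κ × S) × ι => blk q.1.2) GExt
        (fun a a' => B₀ * B6.c1 d ρ α' *
          (1 - kappa385 B₀
            (cV385 (Fintype.card κ) α₁ C₀ (M₂ * (∑ i, ‖b i‖) * Real.exp (δ * d₀))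
              + ∑ _k ∈ (Finset.univ : Finset (κ ⊕ κ)),
                (10 + 8 * Fintype.card κ + (16 * Fintype.card κ + 12) * C₀) * (M₂ * (∑ i, ‖b i‖) * Real.exp (δ * d₀)))
            κ₁ κ₂ Λ (B6.c1 d δ₀ β) * α₁ * B6.c1 d ρ α')⁻¹ *
          g.len a ^ 2 * Real.exp (-((1 - α') * ρ * g.dist a a'))) ∧
      HasMajorant (g := toB6 g Rr H) (fun q : (κ × S) × ι => blk q.1.2) (GExt * Ds)
        (fun a a' => B₀ * Λρ ^ 2 * B6.c1 d ρ α' *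
          (1 - kappa385 B₀
            (cV385 (Fintype.card κ) α₁ C₀ (M₂ * (∑ i, ‖b i‖) * Real.exp (δ * d₀))
              + ∑ _k ∈ (Finset.univ : Finset (κ ⊕ κ)),
                (10 + 8 * Fintype.card κ + (16 * Fintype.card κ + 12) * C₀) * (M₂ * (∑ i, ‖b i‖) * Real.exp (δ * d₀)))
            κ₁ κ₂ Λ (B6.c1 d δ₀ β) * α₁ * B6.c1 d ρ α')⁻¹ *
          g.len a * Real.exp (-((1 - 3 * α') * ρ * g.dist a a'))) := by
  have hbsum : 0 ≤ ∑ i, ‖b i‖ := Finset.sum_nonneg fun i _ => norm_nonneg _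
  have hcard : (0 : ℝ) ≤ Fintype.card κ := Nat.cast_nonneg _
  have hΛ0 : 0 ≤ Λ := zero_le_one.trans hΛ
  have hδP0 : 0 ≤ δP := le_trans (by positivity) hrP
  have hκ₁0 : 0 ≤ κ₁ := by
    rw [hκ₁]
    exact kappa377_nonneg (by positivity) hκP hκP' hΛ0 (B6RandomWalk.c1_nonneg d δ₀ β) hα₁
  -- (3.76) with `P₁` concrete (FILE 10) and (3.77) for it (§2), at the output rate `δ`
  have h376 := eq376_concrete T U b hη.ne' A P Pp
  have hP₁ := ineq377_concreteE (Rr := Rr) (H := H) b T U blk d δ₀ δP α β δ Λ κP κP' α₁ d₀ M₂ hκP hκP' hα₁ hΛ hδ hα hβ hδ₀ hδP0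
    hM₂ hrP hdnn htri hlen h261 hT1i hrepr hη hU1 A hA (fun ν x => hAτB ν ν x) hsmall hd₀F hd₀B hP hDP hPDs hPp hDPp hPpDs
    hDPpDs
  rw [← hκ₁] at hP₁
  exact thm34_G_entries13_concreteV₃ (Rr := Rr) (H := H) b T U blk d δ₀ δ α β ρ α' Λ Λρ B₀ κ₁ κ₂ α₁ C₀ d₀ M₂ hB₀ hκ₁0 hκ₂ hα₁ hC₀
    hΛ0 hΛρ hρ hα hβ hδ₀ hδ hM₂ hr hα' hα'ρ0 hα'ρ2 hdnn htri hrefl hsym hlen h261 h261' hT1 hT2 hT1i hT2i hTρ hsmall385 hrepr hη hL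
    A hT hsmall hU1 h337B h337F h337B' h337Bτ h337FB hA hAτB hAτF hAFB hAst hAloc hdAst h35 hd₀B hd₀F hd₀FB hd₀st hd₀loc hd₀0
    h376 h380 h380s hP₂def hΔG hGΔ hP₁ hP₂ hG hDG hGD hGDs

end Assembly

end Literature.MathematicalPhysics.QuantumFieldTheory.Balaban1983to89.B9Ineq377POneConcrete

end
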